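import Summits.RiemannHypothesis.RiemannHypothesis.Theorems.WeilWindowFlowGronwallLeakageStubFiniteDiniBridge
import Summits.RiemannHypothesis.RiemannHypothesis.Theorems.WeilWindowFlowWindowLipschitz
import HarnessLib

/-!
# Stub `stub_finiteDiniOffCountable` of line `Sketch` for crux `GronwallLeakage` (item stmt-RiemannHypothesis-1037)

**What is proved** (the registered stub, verbatim, unconditionally): off a countable set of windows
(in fact off `∅`) the lower-right Dini derivate of the window bottom `ε = weilGroundEnergy` is finite —
every `a > 0` admits `M` with `-(M h) ≤ ε (a + h) - ε a` for all small `h > 0`.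

**Proof.** The sibling crux `WindowLipschitz` (item stmt-RiemannHypothesis-1039: `ε` is one-sidedly
Lipschitz on every compact window range `[b₀, A] ⊂ (0, ∞)`) is now a tree theorem,
`WindowLipschitz_proof` (`Theorems/WeilWindowFlowWindowLipschitz.lean`: closed Markov form, weak
Euler–Lagrange identity, Feulefack–Jarohs–Weth sup bound, the borderline-barrier edge law
`‖u‖² log(1/(a−|x|)) ≤ K`, IMS cut and dyadic commutator bound), and the landed bridge
`finiteDiniOffCountable_of_windowLipschitz` (`Theorems/WeilWindowFlowGronwallLeakageStubFiniteDiniBridge.lean`,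
`s = ∅`, `M = L(a, a + 1)`) turns it into the stub.

With the landed neighbour `stub_acOfDini` this closes the regularity half (`LogAC`) of line `Sketch`'s cut
`GronwallLeakage ⟺ StrictPos ∧ LogAC`; the remaining stub `stub_strictPos` is RH-equivalent
(`strictPos_iff_riemannHypothesis`, `Theorems/WeilWindowFlowGronwallLeakageCalibration.lean`).
Axioms ⊆ {propext, Classical.choice, Quot.sound}.
-/

-- `Summit.RiemannHypothesis.RiemannHypothesis.…` repeats a namespace component by design (D-0017 layout).
set_option linter.dupNamespace false

noncomputable section

open MeasureTheory Set Filter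
open scoped Topology

namespace Summit.RiemannHypothesis.RiemannHypothesis.Theorems.WeilWindowFlowGronwallLeakage

open Literature.NumberTheory.LFunctions
open Summit.RiemannHypothesis.RiemannHypothesis.Theorems.WeilWindowFlowWindowLipschitz (WindowLipschitz_proof)

/-- **Stub `stub_finiteDiniOffCountable` (line `Sketch`, crux `GronwallLeakage`).** Off a countable set of
windows the lower-right Dini derivate of the window bottom `ε` is finite: for every `a > 0` outside `s`
there is `M` with `-(M h) ≤ ε (a + h) - ε a` for all small `h > 0`. Unconditional: `WindowLipschitz_proof`
(crux 1039, landed) through the bridge `finiteDiniOffCountable_of_windowLipschitz` (`s = ∅`). [folklore] -/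
theorem stub_finiteDiniOffCountable :
    ∃ s : Set ℝ, s.Countable ∧ ∀ a : ℝ, 0 < a → a ∉ s →
      ∃ M : ℝ, ∀ᶠ h in 𝓝[>] (0 : ℝ), -(M * h) ≤ weilGroundEnergy (a + h) - weilGroundEnergy a :=
  finiteDiniOffCountable_of_windowLipschitz WindowLipschitz_proof

end Summit.RiemannHypothesis.RiemannHypothesis.Theorems.WeilWindowFlowGronwallLeakage

end
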